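import Mathlib
import Literature.MathematicalPhysics.MHD.BallooningFieldLine
import Literature.MathematicalPhysics.MHD.StellaratorAverageCurvature
import HarnessLib

/-!
# Why `⟨κ_ψ⟩ > 0` is the stellarator guideline: the flute lower bound of the ballooning energy and the
# parallel-current constraint (Freidberg 2014 §12.12.2–§12.12.3, eqs. (12.225)–(12.232)) — PROVED

Topic `Literature/MathematicalPhysics/MHD` (namespace = path; sub-namespace `Stellarator`).  Bridges the
tree's field-line ballooning functional `Ballooning.FieldLine.energy P Q X X′ a b = ∫ₐᵇ (PX′² − QX²) dl`
(`BallooningFieldLine.lean`, Freidberg (12.38)/(12.52)) to the GUIDELINE `FavourableAverageCurvature`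
(12.232) of `StellaratorAverageCurvature.lean`, exactly along the printed derivation.

## The printed objects
* (12.226) the stellarator ballooning energy in arc length on the line `(ψ, α)`:
  `W̄ = ∫ [k_⊥²|∂X/∂l|² − 2μ₀ p′ (k_α²κ_ψ − k_αk_ψκ_α)|X|²] dl/B` — i.e. the tree's `FieldLine.energy`
  with `P = k_⊥²/B` and `Q = 2μ₀ p′ (k_α²κ_ψ − k_αk_ψκ_α)/B` (`p′ = dp/dψ`; `k_α, k_ψ` constants on the
  line).
* (12.227)–(12.228) the flute trial function (`X` independent of `l`) and the lower bound obtained by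
  dropping the non-negative line-bending term: `W̄ ≥ −2μ₀p′|X|²∫(k_α²κ_ψ − k_αk_ψκ_α) dl/B`.
* (12.225) the parallel-current constraint `∂(J_∥/B)/∂l = (2/B) p′ κ_α`; (12.229)–(12.230) hence
  `∫κ_α dl/B = (1/2p′)∫∂_l(J_∥/B) dl = 0` («a perfect differential»); (12.231)
  `W̄ ≥ −2μ₀ p′ k_α² |X|² ∫κ_ψ dl/B`; (12.232) «for a standard negative pressure gradient … a good
  guideline for stability is `⟨κ_ψ⟩ > 0`».

## What is proved (no named facts) — on ONE PERIOD `l ∈ [0, L]` of the line (the printed `±∞` limits with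
the Gaussian cut-off (12.227) are replaced by periodicity of `J_∥/B`, which is what makes the boundary term
of (12.230) vanish)
`energy_ge_neg_drive` (12.228) (drop `PX′² ≥ 0`); `energy_flute` (the flute value `−X²∫Q`);
★ `integral_kappaAlpha_eq_zero` (12.230) from the constraint in `HasDerivAt` form and `j(0) = j(L)`;
★ `energy_flute_eq` (12.231): `W̄[X ≡ X₀] = −2μ₀ p′ k_α² X₀² ∫₀ᴸ κ_ψ dl/B`; ★ `energy_flute_nonneg_iff` /
`energy_flute_pos_iff_favourable` (12.232): for `μ₀ > 0`, `p′ < 0`, `k_α ≠ 0`, `X₀ ≠ 0` the flute energy is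
`≥ 0` iff `∫₀ᴸ κ_ψ dl/B ≥ 0`, and `> 0` iff `FavourableAverageCurvature L B κ_ψ`.

## Three columns (GRIDFUSION)
CERTIFIED = the calculus of (12.228)–(12.232) on the printed functional.  VALIDATED = nothing.  MODELLED =
the ballooning representation (12.226) itself, the flute trial function, one-period periodicity in place of
the printed `±∞` localisation, the constraint (12.225) as a hypothesis on the data; by the book's own words
the result is «neither necessary nor sufficient», a «plausible estimate».

## Sources, as printed (read on the page, 2026-08-27)
* J. P. Freidberg, *Ideal MHD*, CUP 2014 [Freidberg2014]: §12.12.2 eq. (12.225), §12.12.3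
  eqs. (12.226)–(12.232) [galaxy:panama:388488381857833 chunks p0530–p0531].
Typer/prover: gridfusion-lit-3 (g8), 2026-08-27.
-/

noncomputable section

namespace Literature.MathematicalPhysics.MHD

namespace Stellarator

open _root_.Real _root_.Set _root_.MeasureTheory intervalIntegral Ballooning

/-! ## §1 The flute lower bound (12.228) and the flute value of the tree's field-line energy -/

/-- Eq. (12.228): dropping the non-negative line-bending term gives the lower bound
`W̄[X] ≥ −∫ₐᵇ Q X² dl` whenever `P ≥ 0` on `[a, b]` (integrable pieces).
[cite: Freidberg2014, §12.12.3 eq. (12.228)] -/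
theorem energy_ge_neg_drive {P Q X X' : ℝ → ℝ} {a b : ℝ} (hab : a ≤ b)
    (hP : ∀ l ∈ Icc a b, 0 ≤ P l)
    (hPX : IntervalIntegrable (fun l => P l * X' l ^ 2) volume a b)
    (hQX : IntervalIntegrable (fun l => Q l * X l ^ 2) volume a b) :
    -(∫ l in a..b, Q l * X l ^ 2) ≤ FieldLine.energy P Q X X' a b := by
  unfold FieldLine.energy FieldLine.energyDensity
  rw [intervalIntegral.integral_sub hPX hQX]
  have h0 : 0 ≤ ∫ l in a..b, P l * X' l ^ 2 :=
    intervalIntegral.integral_nonneg hab fun l hl => mul_nonneg (hP l hl) (sq_nonneg _)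
  linarith

/-- The FLUTE trial function `X ≡ X₀` (no `l`-dependence, (12.227) on one period): its energy is
`−X₀² ∫ₐᵇ Q dl`. [cite: Freidberg2014, §12.12.3 eqs. (12.227)–(12.228)] -/
theorem energy_flute (P Q : ℝ → ℝ) (X₀ a b : ℝ) :
    FieldLine.energy P Q (fun _ => X₀) (fun _ => 0) a b = -(X₀ ^ 2 * ∫ l in a..b, Q l) := by
  unfold FieldLine.energy FieldLine.energyDensity
  rw [← intervalIntegral.integral_const_mul, ← intervalIntegral.integral_neg]
  congr 1; funext l; ring

/-! ## §2 The parallel-current constraint kills the `κ_α` term, eqs. (12.225), (12.229)–(12.230) -/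

/-- ★ Eq. (12.230): on one period `[0, L]` of the line, if `j = J_∥/B` satisfies the parallel-current
constraint (12.225) `dj/dl = (2 p′/B) κ_α` with `κ_α/B` continuous and is PERIODIC, `j(0) = j(L)`, and
`p′ ≠ 0`, then `∫₀ᴸ κ_α dl/B = 0` («the integrand is a perfect differential»).
[cite: Freidberg2014, §12.12.2 eq. (12.225), §12.12.3 eqs. (12.229)–(12.230)] -/
theorem integral_kappaAlpha_eq_zero {L dp : ℝ} {B κα j : ℝ → ℝ} (hL : 0 ≤ L) (hdp : dp ≠ 0)
    (hcont : Continuous fun l => κα l / B l)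
    (hj : ∀ l ∈ Icc 0 L, HasDerivAt j (2 * dp / B l * κα l) l) (hper : j 0 = j L) :
    ∫ l in (0:ℝ)..L, κα l / B l = 0 := by
  have hderiv : ∀ l ∈ uIcc 0 L, HasDerivAt j ((2 * dp) * (κα l / B l)) l := by
    intro l hl
    rw [uIcc_of_le hL] at hl
    have := hj l hl
    convert this using 1
    ring
  have hint : IntervalIntegrable (fun l => (2 * dp) * (κα l / B l)) volume 0 L :=
    (continuous_const.mul hcont).intervalIntegrable _ _
  have hFTC := intervalIntegral.integral_eq_sub_of_hasDerivAt hderiv hint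
  rw [intervalIntegral.integral_const_mul, hper, sub_self] at hFTC
  have h2 : (2 * dp) ≠ 0 := mul_ne_zero two_ne_zero hdp
  exact (mul_eq_zero.mp hFTC).resolve_left h2

/-! ## §3 The guideline, eqs. (12.231)–(12.232) -/

/-- The stellarator drive coefficient of (12.226) in the tree's `FieldLine` form:
`Q(l) = 2μ₀ p′ (k_α² κ_ψ(l) − k_α k_ψ κ_α(l))/B(l)`. [cite: Freidberg2014, §12.12.3 eq. (12.226)] -/
def fluteDrive (μ₀ dp kα kψ : ℝ) (B κψ κα : ℝ → ℝ) (l : ℝ) : ℝ :=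
  2 * μ₀ * dp * (kα ^ 2 * κψ l - kα * kψ * κα l) / B l

/-- ★ Eq. (12.231): under the parallel-current constraint the flute energy on one period is
`W̄[X ≡ X₀] = −2μ₀ p′ k_α² X₀² ∫₀ᴸ κ_ψ dl/B` (for ANY line-bending coefficient `P`, which the flute
function does not see). [cite: Freidberg2014, §12.12.3 eq. (12.231)] -/
theorem energy_flute_eq {L μ₀ dp kα kψ X₀ : ℝ} {P B κψ κα j : ℝ → ℝ} (hL : 0 ≤ L) (hdp : dp ≠ 0)
    (hψ : Continuous fun l => κψ l / B l) (hα : Continuous fun l => κα l / B l)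
    (hj : ∀ l ∈ Icc 0 L, HasDerivAt j (2 * dp / B l * κα l) l) (hper : j 0 = j L) :
    FieldLine.energy P (fluteDrive μ₀ dp kα kψ B κψ κα) (fun _ => X₀) (fun _ => 0) 0 L
      = -(2 * μ₀ * dp * kα ^ 2 * X₀ ^ 2) * ∫ l in (0:ℝ)..L, κψ l / B l := by
  rw [energy_flute]
  have hsplit : (∫ l in (0:ℝ)..L, fluteDrive μ₀ dp kα kψ B κψ κα l)
      = 2 * μ₀ * dp * kα ^ 2 * (∫ l in (0:ℝ)..L, κψ l / B l)
        - 2 * μ₀ * dp * kα * kψ * (∫ l in (0:ℝ)..L, κα l / B l) := by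
    have h1 : IntervalIntegrable (fun l => 2 * μ₀ * dp * kα ^ 2 * (κψ l / B l)) volume 0 L :=
      (continuous_const.mul hψ).intervalIntegrable _ _
    have h2 : IntervalIntegrable (fun l => 2 * μ₀ * dp * kα * kψ * (κα l / B l)) volume 0 L :=
      (continuous_const.mul hα).intervalIntegrable _ _
    rw [← intervalIntegral.integral_const_mul, ← intervalIntegral.integral_const_mul,
      ← intervalIntegral.integral_sub h1 h2]
    refine intervalIntegral.integral_congr fun l _ => ?_
    simp only [fluteDrive]
    ring
  rw [hsplit, integral_kappaAlpha_eq_zero hL hdp hα hj hper]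
  ring

/-- ★ Eq. (12.232), non-strict form: for `μ₀ > 0`, a «standard negative pressure gradient» `p′ < 0`,
`k_α ≠ 0` and a non-trivial flute `X₀ ≠ 0`, the flute energy (12.231) is `≥ 0` IFF `∫₀ᴸ κ_ψ dl/B ≥ 0`.
[cite: Freidberg2014, §12.12.3 eqs. (12.231)–(12.232)] -/
theorem energy_flute_nonneg_iff {L μ₀ dp kα kψ X₀ : ℝ} {P B κψ κα j : ℝ → ℝ} (hL : 0 ≤ L)
    (hμ : 0 < μ₀) (hdp : dp < 0) (hkα : kα ≠ 0) (hX : X₀ ≠ 0)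
    (hψ : Continuous fun l => κψ l / B l) (hα : Continuous fun l => κα l / B l)
    (hj : ∀ l ∈ Icc 0 L, HasDerivAt j (2 * dp / B l * κα l) l) (hper : j 0 = j L) :
    0 ≤ FieldLine.energy P (fluteDrive μ₀ dp kα kψ B κψ κα) (fun _ => X₀) (fun _ => 0) 0 L
      ↔ 0 ≤ ∫ l in (0:ℝ)..L, κψ l / B l := by
  rw [energy_flute_eq hL hdp.ne hψ hα hj hper]
  have hc : 0 < -(2 * μ₀ * dp * kα ^ 2 * X₀ ^ 2) := by
    have h1 : 0 < kα ^ 2 := by positivity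
    have h2 : 0 < X₀ ^ 2 := by positivity
    have : 2 * μ₀ * dp * kα ^ 2 * X₀ ^ 2 < 0 := by
      have : 0 < 2 * μ₀ * kα ^ 2 * X₀ ^ 2 := by positivity
      nlinarith
    linarith
  constructor
  · intro h
    by_contra hneg
    have hneg' : (∫ l in (0:ℝ)..L, κψ l / B l) < 0 := not_le.mp hneg
    have : -(2 * μ₀ * dp * kα ^ 2 * X₀ ^ 2) * ∫ l in (0:ℝ)..L, κψ l / B l < 0 :=
      mul_neg_of_pos_of_neg hc hneg'
    linarith
  · intro h
    exact mul_nonneg hc.le h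

/-- ★ Eq. (12.232), as printed: with `B > 0` continuous on the line and `L > 0`, the flute energy is
STRICTLY positive IFF the line has FAVOURABLE AVERAGE CURVATURE `⟨κ_ψ⟩ > 0`
(`Stellarator.FavourableAverageCurvature`, (12.232)–(12.233)) — the GUIDELINE.
[cite: Freidberg2014, §12.12.3 eqs. (12.231)–(12.233)] -/
theorem energy_flute_pos_iff_favourable {L μ₀ dp kα kψ X₀ : ℝ} {P B κψ κα j : ℝ → ℝ} (hL : 0 < L)
    (hμ : 0 < μ₀) (hdp : dp < 0) (hkα : kα ≠ 0) (hX : X₀ ≠ 0)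
    (hB : Continuous B) (hBpos : ∀ l, 0 < B l) (hκψ : Continuous κψ)
    (hα : Continuous fun l => κα l / B l)
    (hj : ∀ l ∈ Icc 0 L, HasDerivAt j (2 * dp / B l * κα l) l) (hper : j 0 = j L) :
    0 < FieldLine.energy P (fluteDrive μ₀ dp kα kψ B κψ κα) (fun _ => X₀) (fun _ => 0) 0 L
      ↔ FavourableAverageCurvature L B κψ := by
  have hψ : Continuous fun l => κψ l / B l := hκψ.div hB fun l => (hBpos l).ne'
  rw [energy_flute_eq hL.le hdp.ne hψ hα hj hper, favourable_iff hL hB hBpos]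
  have hc : 0 < -(2 * μ₀ * dp * kα ^ 2 * X₀ ^ 2) := by
    have : 2 * μ₀ * dp * kα ^ 2 * X₀ ^ 2 < 0 := by
      have : 0 < 2 * μ₀ * kα ^ 2 * X₀ ^ 2 := by positivity
      nlinarith
    linarith
  exact mul_pos_iff_of_pos_left hc

end Stellarator

end Literature.MathematicalPhysics.MHD
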